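/-
Copyright: the b2b-balaban T⁴-continuum CRUX team, row NE7b OWNER lineage `t4-ne7b-p1` (gen 146). Project licence.
-/
import Summits.QuantumFields.BalabanUV.T4Continuum.Spine.NE7b.SupHomogeneousVertexBounds
import Summits.QuantumFields.BalabanUV.T4Continuum.Spine.NE7b.SupWhitenedThirdGradGradCumulantRaw

/-!
# HOMOGENEOUS THREE-POINT BOUNDS WITH GENERAL BOUNDED VERTICES — TILTED FORMAT UNDER `N(0,AAᵀ)` (SCOPING-d17 §F, F9–F10: the order-5
# interpolation inputs, third file).  (674) bounds the centred triples with one ∕ two bounded vertex observables `P`, `Q` in the Gibbs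
# format (whitened tilted law).  The order-5 entry majorant (610) and its pieces (603) are written in the TILTED format
# `Z⁻¹∫e^{−U(ω+ψ)}(…)dN(0,AAᵀ)(ω)` with tilted means; THIS FILE transports the four bounds there by (566)'s `whitened_observable_bridge`
# (any continuous observable):
#   vertex first ∕ middle `≤ 2β·√M₁`;   two vertices (1,2) ∕ (2,3) `≤ 4β₁β₂·√√M₁`   (`M₁ = 5κ₂⁴γ_op²∕(1−λγ_op)²`)
# — instantiated by the next file at `P = U‴(·)[e_x,e_y,e_z]` (`β = K3_{yzx}`) and `P, Q =` Hessian riders (`β = Hk`) and interpolated against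
# (567)∕(568)∕(570)∕(571)'s decay bounds (row NE7b, node U5c; (566), (674) BY NAME; [folklore]).

Cell `pub-balaban`, sub-cell `t4`, spine estimate NE7b (`T4WeightBudget.RelWeightBound`; the cell's OWN estimate — NOT PRINTED in
[Bałaban 1983–89], NOT PROVED).  Crux-route work under `Spine/NE7b/` by the row OWNER (`t4-ne7b-p1` gen 146, file (675)) under FREEZE
(0)'s crux-prover clause; NOTHING of Bałaban's is named as a Lean object, valued or asserted; no `T4Continuum/Support` leaf typed; no
`def`, no notation (every display WRITTEN OUT); zero `sorry`.  Imports (BY NAME): the OWNER's (674) `…SupHomogeneousVertexBounds`, (566)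
`…SupWhitenedThirdGradGradCumulantRaw` (`whitened_observable_bridge`).

WHAT IS PROVED ([folklore]): **`tilted_triple_vertex_first`**, **`tilted_triple_vertex_middle`**, **`tilted_triple_two_vertices`**,
**`tilted_triple_two_vertices_23`**; toy.

HONEST (what this is NOT).  Format transport of moment inequalities; the four-point instances and the interpolated order-5 entries `M₅′` are
the next files; scalar skeleton ((A3), NC-NE7b-α UNRULED); nothing of Bałaban's asserted.  BY-NAME EFFECT ON THE WALL: NONE.  NE7b NOT PRINTED ∕
NOT PROVED; spine PROVED 0∕9; rung (B)+1 — the programme's measures remain FINITE-torus statements; NOT the mass gap, NOT Clay.  HONEST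
DEPENDENCY: continuum YM on T⁴ ⇐ BetaPertH ∧ nine spine estimates (0∕9 proved); BetaPertH ⇐ (D1) ∧ (D4) ∧ CAP+tail; G-an2-4 gates asym, D1 and
NE2∕3∕4.
-/

set_option autoImplicit false
set_option maxSynthPendingDepth 2

noncomputable section

namespace Summit.QuantumFields.BalabanUV.T4Continuum.NE7b.SupHomogeneousVertexBoundsTilted

open MeasureTheory ProbabilityTheory Real Set Function Finset Matrix
open scoped BigOperators
open Literature.Probability.Distributions (matrixCLM)
open SupWhitenedThirdGradGradCumulantRaw (whitened_observable_bridge)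
open SupHomogeneousVertexBounds (gibbs_triple_vertex_first gibbs_triple_vertex_middle gibbs_triple_two_vertices gibbs_triple_two_vertices_23)

variable {ι κ : Type} [Fintype ι] [DecidableEq ι] [Fintype κ] [DecidableEq κ]

variable {U : EuclideanSpace ℝ ι → ℝ} {U' : EuclideanSpace ℝ ι → EuclideanSpace ℝ ι →L[ℝ] ℝ}
  {U'' : EuclideanSpace ℝ ι → EuclideanSpace ℝ ι →L[ℝ] EuclideanSpace ℝ ι →L[ℝ] ℝ}
  {A : Matrix ι κ ℝ} {γop κ₀ κ₁ κ₂ a τ δ θp lam : ℝ}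

/-- **ONE BOUNDED VERTEX FIRST, TILTED FORMAT**: for a continuous `P` with `|P| ≤ β`, `|Z⁻¹∫e^{−U}(P − E P)(U′e_z − a_z)(U′e_t − a_t) dN(0,AAᵀ)|
        ≤ 2β·√M₁`. [folklore] -/
theorem tilted_triple_vertex_first [Nonempty κ] (hΓop : (γop • (1 : Matrix ι ι ℝ) - A * Aᵀ).PosSemidef) (Y : Finset ι)
    (hUd : ∀ φ : EuclideanSpace ℝ ι, HasFDerivAt U (U' φ) φ) (hU'd : ∀ φ : EuclideanSpace ℝ ι, HasFDerivAt U' (U'' φ) φ) (hU''c : Continuous U'')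
    (hκ₀ : 0 ≤ κ₀) (hκ₁ : 0 ≤ κ₁) (ha : 0 ≤ a) (hτ : 0 < τ) (hδ : 0 < δ) (hθ0 : 0 < θp) (hθ1 : θp < 1) (hκθ : (2 * κ₀ * (1 + τ) + 4 * δ) * γop ≤ θp)
    (hstab : ∀ φ : EuclideanSpace ℝ ι, -(κ₀ * ∑ x ∈ Y, φ x ^ 2) ≤ U φ) (hU'b : ∀ φ : EuclideanSpace ℝ ι, ‖U' φ‖ ≤ κ₁ * (a + ∑ x ∈ Y, φ x ^ 2))
    (hU''b : ∀ φ : EuclideanSpace ℝ ι, ‖U'' φ‖ ≤ κ₂) (hlam : 0 ≤ lam)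
    (hUsec : ∀ s : ℝ, 0 ≤ s → s ≤ 1 → ∀ a b : EuclideanSpace ℝ ι, U ((1 - s) • a + s • b) - lam / 2 * (s * (1 - s)) * ∑ i, (a i - b i) ^ 2 ≤ (1 -
        s) * U a + s * U b)
    (hρ : lam * γop < 1) {P : EuclideanSpace ℝ ι → ℝ} {β : ℝ} (hβ : 0 ≤ β) (hP : ∀ φ, |P φ| ≤ β) (hPc : Continuous P) (ψ : EuclideanSpace ℝ ι) (z
        t : ι) :
    |((∫ ω : EuclideanSpace ℝ ι, exp (-U (ω + ψ)) ∂(multivariateGaussian 0 (A * Aᵀ)))⁻¹ * (∫ ω : EuclideanSpace ℝ ι, exp (-U (ω + ψ)) * ((P (ω +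
        ψ) - ((∫ ω : EuclideanSpace ℝ ι, exp (-U (ω + ψ)) ∂(multivariateGaussian 0 (A * Aᵀ)))⁻¹ * (∫ ω : EuclideanSpace ℝ ι, exp (-U (ω + ψ)) * P
        (ω + ψ) ∂(multivariateGaussian 0 (A * Aᵀ))))) * (U' (ω + ψ) (EuclideanSpace.single z (1 : ℝ)) - ((∫ ω : EuclideanSpace ℝ ι, exp (-U (ω +
        ψ)) ∂(multivariateGaussian 0 (A * Aᵀ)))⁻¹ * (∫ ω : EuclideanSpace ℝ ι, exp (-U (ω + ψ)) * U' (ω + ψ) (EuclideanSpace.single z (1 : ℝ))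
        ∂(multivariateGaussian 0 (A * Aᵀ))))) * (U' (ω + ψ) (EuclideanSpace.single t (1 : ℝ)) - ((∫ ω : EuclideanSpace ℝ ι, exp (-U (ω + ψ))
        ∂(multivariateGaussian 0 (A * Aᵀ)))⁻¹ * (∫ ω : EuclideanSpace ℝ ι, exp (-U (ω + ψ)) * U' (ω + ψ) (EuclideanSpace.single t (1 : ℝ))
        ∂(multivariateGaussian 0 (A * Aᵀ)))))) ∂(multivariateGaussian 0 (A * Aᵀ))))| ≤
      2 * β * Real.sqrt (5 * (κ₂ ^ 4 * γop ^ 2) / (1 - lam * γop) ^ 2) := by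
  have hUc : Continuous U := continuous_iff_continuousAt.2 fun φ => (hUd φ).continuousAt
  have hU'c : Continuous U' := continuous_iff_continuousAt.2 fun φ => (hU'd φ).continuousAt
  have h := gibbs_triple_vertex_first hΓop Y hUd hU'd hU''c hκ₀ hκ₁ ha hτ hδ hθ0 hθ1 hκθ hstab hU'b hU''b hlam hUsec hρ hβ hP ψ z t
  have htr := whitened_observable_bridge (U := U) hUc A ψ (p := fun φ => (P φ - ∫ w', P (matrixCLM A (WithLp.toLp 2 w') + ψ) ∂((volume : Measure (κ
    → ℝ)).tilted fun z => -(1 / 2 * (z ⬝ᵥ z) + U (matrixCLM A (WithLp.toLp 2 z) + ψ)))) * (U' φ (EuclideanSpace.single z (1 : ℝ)) - ∫ w', U'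
    (matrixCLM A (WithLp.toLp 2 w') + ψ) (EuclideanSpace.single z (1 : ℝ)) ∂((volume : Measure (κ → ℝ)).tilted fun z => -(1 / 2 * (z ⬝ᵥ z) + U
    (matrixCLM A (WithLp.toLp 2 z) + ψ)))) * (U' φ (EuclideanSpace.single t (1 : ℝ)) - ∫ w', U' (matrixCLM A (WithLp.toLp 2 w') + ψ)
    (EuclideanSpace.single t (1 : ℝ)) ∂((volume : Measure (κ → ℝ)).tilted fun z => -(1 / 2 * (z ⬝ᵥ z) + U (matrixCLM A (WithLp.toLp 2 z) + ψ)))))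
    ((((hPc).sub continuous_const).mul (((hU'c.clm_apply continuous_const)).sub continuous_const)).mul (((hU'c.clm_apply continuous_const)).sub
    continuous_const))
  beta_reduce at htr
  have hm0 := whitened_observable_bridge (U := U) hUc A ψ (p := fun φ => P φ) hPc
  beta_reduce at hm0
  have hm1 := whitened_observable_bridge (U := U) hUc A ψ (p := fun φ => U' φ (EuclideanSpace.single z (1 : ℝ))) (hU'c.clm_apply continuous_const)
  beta_reduce at hm1
  have hm2 := whitened_observable_bridge (U := U) hUc A ψ (p := fun φ => U' φ (EuclideanSpace.single t (1 : ℝ))) (hU'c.clm_apply continuous_const)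
  beta_reduce at hm2
  rw [htr, hm0, hm1, hm2] at h
  exact h

/-- **ONE BOUNDED VERTEX IN THE MIDDLE, TILTED FORMAT**: `|Z⁻¹∫e^{−U}(U′e_x − a_x)(P − E P)(U′e_t − a_t) dN(0,AAᵀ)| ≤ 2β·√M₁`. [folklore] -/
theorem tilted_triple_vertex_middle [Nonempty κ] (hΓop : (γop • (1 : Matrix ι ι ℝ) - A * Aᵀ).PosSemidef) (Y : Finset ι)
    (hUd : ∀ φ : EuclideanSpace ℝ ι, HasFDerivAt U (U' φ) φ) (hU'd : ∀ φ : EuclideanSpace ℝ ι, HasFDerivAt U' (U'' φ) φ) (hU''c : Continuous U'')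
    (hκ₀ : 0 ≤ κ₀) (hκ₁ : 0 ≤ κ₁) (ha : 0 ≤ a) (hτ : 0 < τ) (hδ : 0 < δ) (hθ0 : 0 < θp) (hθ1 : θp < 1) (hκθ : (2 * κ₀ * (1 + τ) + 4 * δ) * γop ≤ θp)
    (hstab : ∀ φ : EuclideanSpace ℝ ι, -(κ₀ * ∑ x ∈ Y, φ x ^ 2) ≤ U φ) (hU'b : ∀ φ : EuclideanSpace ℝ ι, ‖U' φ‖ ≤ κ₁ * (a + ∑ x ∈ Y, φ x ^ 2))
    (hU''b : ∀ φ : EuclideanSpace ℝ ι, ‖U'' φ‖ ≤ κ₂) (hlam : 0 ≤ lam)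
    (hUsec : ∀ s : ℝ, 0 ≤ s → s ≤ 1 → ∀ a b : EuclideanSpace ℝ ι, U ((1 - s) • a + s • b) - lam / 2 * (s * (1 - s)) * ∑ i, (a i - b i) ^ 2 ≤ (1 -
        s) * U a + s * U b)
    (hρ : lam * γop < 1) {P : EuclideanSpace ℝ ι → ℝ} {β : ℝ} (hβ : 0 ≤ β) (hP : ∀ φ, |P φ| ≤ β) (hPc : Continuous P) (ψ : EuclideanSpace ℝ ι) (x
        t : ι) :
    |((∫ ω : EuclideanSpace ℝ ι, exp (-U (ω + ψ)) ∂(multivariateGaussian 0 (A * Aᵀ)))⁻¹ * (∫ ω : EuclideanSpace ℝ ι, exp (-U (ω + ψ)) * ((U' (ω +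
        ψ) (EuclideanSpace.single x (1 : ℝ)) - ((∫ ω : EuclideanSpace ℝ ι, exp (-U (ω + ψ)) ∂(multivariateGaussian 0 (A * Aᵀ)))⁻¹ * (∫ ω :
        EuclideanSpace ℝ ι, exp (-U (ω + ψ)) * U' (ω + ψ) (EuclideanSpace.single x (1 : ℝ)) ∂(multivariateGaussian 0 (A * Aᵀ))))) * (P (ω + ψ) -
        ((∫ ω : EuclideanSpace ℝ ι, exp (-U (ω + ψ)) ∂(multivariateGaussian 0 (A * Aᵀ)))⁻¹ * (∫ ω : EuclideanSpace ℝ ι, exp (-U (ω + ψ)) * P (ω +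
        ψ) ∂(multivariateGaussian 0 (A * Aᵀ))))) * (U' (ω + ψ) (EuclideanSpace.single t (1 : ℝ)) - ((∫ ω : EuclideanSpace ℝ ι, exp (-U (ω + ψ))
        ∂(multivariateGaussian 0 (A * Aᵀ)))⁻¹ * (∫ ω : EuclideanSpace ℝ ι, exp (-U (ω + ψ)) * U' (ω + ψ) (EuclideanSpace.single t (1 : ℝ))
        ∂(multivariateGaussian 0 (A * Aᵀ)))))) ∂(multivariateGaussian 0 (A * Aᵀ))))| ≤
      2 * β * Real.sqrt (5 * (κ₂ ^ 4 * γop ^ 2) / (1 - lam * γop) ^ 2) := by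
  have hUc : Continuous U := continuous_iff_continuousAt.2 fun φ => (hUd φ).continuousAt
  have hU'c : Continuous U' := continuous_iff_continuousAt.2 fun φ => (hU'd φ).continuousAt
  have h := gibbs_triple_vertex_middle hΓop Y hUd hU'd hU''c hκ₀ hκ₁ ha hτ hδ hθ0 hθ1 hκθ hstab hU'b hU''b hlam hUsec hρ hβ hP ψ x t
  have htr := whitened_observable_bridge (U := U) hUc A ψ (p := fun φ => (U' φ (EuclideanSpace.single x (1 : ℝ)) - ∫ w', U' (matrixCLM A
    (WithLp.toLp 2 w') + ψ) (EuclideanSpace.single x (1 : ℝ)) ∂((volume : Measure (κ → ℝ)).tilted fun z => -(1 / 2 * (z ⬝ᵥ z) + U (matrixCLM A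
    (WithLp.toLp 2 z) + ψ)))) * (P φ - ∫ w', P (matrixCLM A (WithLp.toLp 2 w') + ψ) ∂((volume : Measure (κ → ℝ)).tilted fun z => -(1 / 2 * (z ⬝ᵥ z)
    + U (matrixCLM A (WithLp.toLp 2 z) + ψ)))) * (U' φ (EuclideanSpace.single t (1 : ℝ)) - ∫ w', U' (matrixCLM A (WithLp.toLp 2 w') + ψ)
    (EuclideanSpace.single t (1 : ℝ)) ∂((volume : Measure (κ → ℝ)).tilted fun z => -(1 / 2 * (z ⬝ᵥ z) + U (matrixCLM A (WithLp.toLp 2 z) + ψ)))))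
    (((((hU'c.clm_apply continuous_const)).sub continuous_const).mul ((hPc).sub continuous_const)).mul (((hU'c.clm_apply continuous_const)).sub
    continuous_const))
  beta_reduce at htr
  have hm0 := whitened_observable_bridge (U := U) hUc A ψ (p := fun φ => U' φ (EuclideanSpace.single x (1 : ℝ))) (hU'c.clm_apply continuous_const)
  beta_reduce at hm0
  have hm1 := whitened_observable_bridge (U := U) hUc A ψ (p := fun φ => P φ) hPc
  beta_reduce at hm1
  have hm2 := whitened_observable_bridge (U := U) hUc A ψ (p := fun φ => U' φ (EuclideanSpace.single t (1 : ℝ))) (hU'c.clm_apply continuous_const)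
  beta_reduce at hm2
  rw [htr, hm0, hm1, hm2] at h
  exact h

/-- **TWO BOUNDED VERTICES IN POSITIONS 1, 2, TILTED FORMAT**: `|Z⁻¹∫e^{−U}(P − E P)(Q − E Q)(U′e_s − a_s) dN(0,AAᵀ)| ≤ 4β₁β₂·√√M₁`. [folklore] -/
theorem tilted_triple_two_vertices [Nonempty κ] (hΓop : (γop • (1 : Matrix ι ι ℝ) - A * Aᵀ).PosSemidef) (Y : Finset ι)
    (hUd : ∀ φ : EuclideanSpace ℝ ι, HasFDerivAt U (U' φ) φ) (hU'd : ∀ φ : EuclideanSpace ℝ ι, HasFDerivAt U' (U'' φ) φ) (hU''c : Continuous U'')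
    (hκ₀ : 0 ≤ κ₀) (hκ₁ : 0 ≤ κ₁) (ha : 0 ≤ a) (hτ : 0 < τ) (hδ : 0 < δ) (hθ0 : 0 < θp) (hθ1 : θp < 1) (hκθ : (2 * κ₀ * (1 + τ) + 4 * δ) * γop ≤ θp)
    (hstab : ∀ φ : EuclideanSpace ℝ ι, -(κ₀ * ∑ x ∈ Y, φ x ^ 2) ≤ U φ) (hU'b : ∀ φ : EuclideanSpace ℝ ι, ‖U' φ‖ ≤ κ₁ * (a + ∑ x ∈ Y, φ x ^ 2))
    (hU''b : ∀ φ : EuclideanSpace ℝ ι, ‖U'' φ‖ ≤ κ₂) (hlam : 0 ≤ lam)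
    (hUsec : ∀ s : ℝ, 0 ≤ s → s ≤ 1 → ∀ a b : EuclideanSpace ℝ ι, U ((1 - s) • a + s • b) - lam / 2 * (s * (1 - s)) * ∑ i, (a i - b i) ^ 2 ≤ (1 -
        s) * U a + s * U b)
    (hρ : lam * γop < 1) {P Q : EuclideanSpace ℝ ι → ℝ} {β₁ β₂ : ℝ} (hβ₁ : 0 ≤ β₁) (hβ₂ : 0 ≤ β₂) (hP : ∀ φ, |P φ| ≤ β₁) (hQ : ∀ φ, |Q φ| ≤ β₂)
        (hPc : Continuous P) (hQc : Continuous Q) (ψ : EuclideanSpace ℝ ι) (s : ι) :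
    |((∫ ω : EuclideanSpace ℝ ι, exp (-U (ω + ψ)) ∂(multivariateGaussian 0 (A * Aᵀ)))⁻¹ * (∫ ω : EuclideanSpace ℝ ι, exp (-U (ω + ψ)) * ((P (ω +
        ψ) - ((∫ ω : EuclideanSpace ℝ ι, exp (-U (ω + ψ)) ∂(multivariateGaussian 0 (A * Aᵀ)))⁻¹ * (∫ ω : EuclideanSpace ℝ ι, exp (-U (ω + ψ)) * P
        (ω + ψ) ∂(multivariateGaussian 0 (A * Aᵀ))))) * (Q (ω + ψ) - ((∫ ω : EuclideanSpace ℝ ι, exp (-U (ω + ψ)) ∂(multivariateGaussian 0 (A *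
        Aᵀ)))⁻¹ * (∫ ω : EuclideanSpace ℝ ι, exp (-U (ω + ψ)) * Q (ω + ψ) ∂(multivariateGaussian 0 (A * Aᵀ))))) * (U' (ω + ψ)
        (EuclideanSpace.single s (1 : ℝ)) - ((∫ ω : EuclideanSpace ℝ ι, exp (-U (ω + ψ)) ∂(multivariateGaussian 0 (A * Aᵀ)))⁻¹ * (∫ ω :
        EuclideanSpace ℝ ι, exp (-U (ω + ψ)) * U' (ω + ψ) (EuclideanSpace.single s (1 : ℝ)) ∂(multivariateGaussian 0 (A * Aᵀ))))))
        ∂(multivariateGaussian 0 (A * Aᵀ))))| ≤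
      4 * β₁ * β₂ * Real.sqrt (Real.sqrt (5 * (κ₂ ^ 4 * γop ^ 2) / (1 - lam * γop) ^ 2)) := by
  have hUc : Continuous U := continuous_iff_continuousAt.2 fun φ => (hUd φ).continuousAt
  have hU'c : Continuous U' := continuous_iff_continuousAt.2 fun φ => (hU'd φ).continuousAt
  have h := gibbs_triple_two_vertices hΓop Y hUd hU'd hU''c hκ₀ hκ₁ ha hτ hδ hθ0 hθ1 hκθ hstab hU'b hU''b hlam hUsec hρ hβ₁ hβ₂ hP hQ ψ s
  have htr := whitened_observable_bridge (U := U) hUc A ψ (p := fun φ => (P φ - ∫ w', P (matrixCLM A (WithLp.toLp 2 w') + ψ) ∂((volume : Measure (κ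
    → ℝ)).tilted fun z => -(1 / 2 * (z ⬝ᵥ z) + U (matrixCLM A (WithLp.toLp 2 z) + ψ)))) * (Q φ - ∫ w', Q (matrixCLM A (WithLp.toLp 2 w') + ψ)
    ∂((volume : Measure (κ → ℝ)).tilted fun z => -(1 / 2 * (z ⬝ᵥ z) + U (matrixCLM A (WithLp.toLp 2 z) + ψ)))) * (U' φ (EuclideanSpace.single s (1 :
    ℝ)) - ∫ w', U' (matrixCLM A (WithLp.toLp 2 w') + ψ) (EuclideanSpace.single s (1 : ℝ)) ∂((volume : Measure (κ → ℝ)).tilted fun z => -(1 / 2 * (z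
    ⬝ᵥ z) + U (matrixCLM A (WithLp.toLp 2 z) + ψ))))) ((((hPc).sub continuous_const).mul ((hQc).sub continuous_const)).mul (((hU'c.clm_apply
    continuous_const)).sub continuous_const))
  beta_reduce at htr
  have hm0 := whitened_observable_bridge (U := U) hUc A ψ (p := fun φ => P φ) hPc
  beta_reduce at hm0
  have hm1 := whitened_observable_bridge (U := U) hUc A ψ (p := fun φ => Q φ) hQc
  beta_reduce at hm1
  have hm2 := whitened_observable_bridge (U := U) hUc A ψ (p := fun φ => U' φ (EuclideanSpace.single s (1 : ℝ))) (hU'c.clm_apply continuous_const)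
  beta_reduce at hm2
  rw [htr, hm0, hm1, hm2] at h
  exact h

/-- **TWO BOUNDED VERTICES IN POSITIONS 2, 3, TILTED FORMAT**: `|Z⁻¹∫e^{−U}(U′e_x − a_x)(P − E P)(Q − E Q) dN(0,AAᵀ)| ≤ 4β₁β₂·√√M₁`. [folklore] -/
theorem tilted_triple_two_vertices_23 [Nonempty κ] (hΓop : (γop • (1 : Matrix ι ι ℝ) - A * Aᵀ).PosSemidef) (Y : Finset ι)
    (hUd : ∀ φ : EuclideanSpace ℝ ι, HasFDerivAt U (U' φ) φ) (hU'd : ∀ φ : EuclideanSpace ℝ ι, HasFDerivAt U' (U'' φ) φ) (hU''c : Continuous U'')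
    (hκ₀ : 0 ≤ κ₀) (hκ₁ : 0 ≤ κ₁) (ha : 0 ≤ a) (hτ : 0 < τ) (hδ : 0 < δ) (hθ0 : 0 < θp) (hθ1 : θp < 1) (hκθ : (2 * κ₀ * (1 + τ) + 4 * δ) * γop ≤ θp)
    (hstab : ∀ φ : EuclideanSpace ℝ ι, -(κ₀ * ∑ x ∈ Y, φ x ^ 2) ≤ U φ) (hU'b : ∀ φ : EuclideanSpace ℝ ι, ‖U' φ‖ ≤ κ₁ * (a + ∑ x ∈ Y, φ x ^ 2))
    (hU''b : ∀ φ : EuclideanSpace ℝ ι, ‖U'' φ‖ ≤ κ₂) (hlam : 0 ≤ lam)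
    (hUsec : ∀ s : ℝ, 0 ≤ s → s ≤ 1 → ∀ a b : EuclideanSpace ℝ ι, U ((1 - s) • a + s • b) - lam / 2 * (s * (1 - s)) * ∑ i, (a i - b i) ^ 2 ≤ (1 -
        s) * U a + s * U b)
    (hρ : lam * γop < 1) {P Q : EuclideanSpace ℝ ι → ℝ} {β₁ β₂ : ℝ} (hβ₁ : 0 ≤ β₁) (hβ₂ : 0 ≤ β₂) (hP : ∀ φ, |P φ| ≤ β₁) (hQ : ∀ φ, |Q φ| ≤ β₂)
        (hPc : Continuous P) (hQc : Continuous Q) (ψ : EuclideanSpace ℝ ι) (x : ι) :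
    |((∫ ω : EuclideanSpace ℝ ι, exp (-U (ω + ψ)) ∂(multivariateGaussian 0 (A * Aᵀ)))⁻¹ * (∫ ω : EuclideanSpace ℝ ι, exp (-U (ω + ψ)) * ((U' (ω +
        ψ) (EuclideanSpace.single x (1 : ℝ)) - ((∫ ω : EuclideanSpace ℝ ι, exp (-U (ω + ψ)) ∂(multivariateGaussian 0 (A * Aᵀ)))⁻¹ * (∫ ω :
        EuclideanSpace ℝ ι, exp (-U (ω + ψ)) * U' (ω + ψ) (EuclideanSpace.single x (1 : ℝ)) ∂(multivariateGaussian 0 (A * Aᵀ))))) * (P (ω + ψ) -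
        ((∫ ω : EuclideanSpace ℝ ι, exp (-U (ω + ψ)) ∂(multivariateGaussian 0 (A * Aᵀ)))⁻¹ * (∫ ω : EuclideanSpace ℝ ι, exp (-U (ω + ψ)) * P (ω +
        ψ) ∂(multivariateGaussian 0 (A * Aᵀ))))) * (Q (ω + ψ) - ((∫ ω : EuclideanSpace ℝ ι, exp (-U (ω + ψ)) ∂(multivariateGaussian 0 (A *
        Aᵀ)))⁻¹ * (∫ ω : EuclideanSpace ℝ ι, exp (-U (ω + ψ)) * Q (ω + ψ) ∂(multivariateGaussian 0 (A * Aᵀ)))))) ∂(multivariateGaussian 0 (A *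
        Aᵀ))))| ≤
      4 * β₁ * β₂ * Real.sqrt (Real.sqrt (5 * (κ₂ ^ 4 * γop ^ 2) / (1 - lam * γop) ^ 2)) := by
  have hUc : Continuous U := continuous_iff_continuousAt.2 fun φ => (hUd φ).continuousAt
  have hU'c : Continuous U' := continuous_iff_continuousAt.2 fun φ => (hU'd φ).continuousAt
  have h := gibbs_triple_two_vertices_23 hΓop Y hUd hU'd hU''c hκ₀ hκ₁ ha hτ hδ hθ0 hθ1 hκθ hstab hU'b hU''b hlam hUsec hρ hβ₁ hβ₂ hP hQ ψ x
  have htr := whitened_observable_bridge (U := U) hUc A ψ (p := fun φ => (U' φ (EuclideanSpace.single x (1 : ℝ)) - ∫ w', U' (matrixCLM A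
    (WithLp.toLp 2 w') + ψ) (EuclideanSpace.single x (1 : ℝ)) ∂((volume : Measure (κ → ℝ)).tilted fun z => -(1 / 2 * (z ⬝ᵥ z) + U (matrixCLM A
    (WithLp.toLp 2 z) + ψ)))) * (P φ - ∫ w', P (matrixCLM A (WithLp.toLp 2 w') + ψ) ∂((volume : Measure (κ → ℝ)).tilted fun z => -(1 / 2 * (z ⬝ᵥ z)
    + U (matrixCLM A (WithLp.toLp 2 z) + ψ)))) * (Q φ - ∫ w', Q (matrixCLM A (WithLp.toLp 2 w') + ψ) ∂((volume : Measure (κ → ℝ)).tilted fun z =>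
    -(1 / 2 * (z ⬝ᵥ z) + U (matrixCLM A (WithLp.toLp 2 z) + ψ))))) (((((hU'c.clm_apply continuous_const)).sub continuous_const).mul ((hPc).sub
    continuous_const)).mul ((hQc).sub continuous_const))
  beta_reduce at htr
  have hm0 := whitened_observable_bridge (U := U) hUc A ψ (p := fun φ => U' φ (EuclideanSpace.single x (1 : ℝ))) (hU'c.clm_apply continuous_const)
  beta_reduce at hm0
  have hm1 := whitened_observable_bridge (U := U) hUc A ψ (p := fun φ => P φ) hPc
  beta_reduce at hm1
  have hm2 := whitened_observable_bridge (U := U) hUc A ψ (p := fun φ => Q φ) hQc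
  beta_reduce at hm2
  rw [htr, hm0, hm1, hm2] at h
  exact h

/-! ## Toy -/

/-- Toy (the bridge's shape on constants): a tilted mean of a constant observable is the constant, `Z⁻¹·(Z·c) = c` for `Z ≠ 0`. -/
example (Z c : ℝ) (hZ : Z ≠ 0) : Z⁻¹ * (Z * c) = c := by field_simp

end Summit.QuantumFields.BalabanUV.T4Continuum.NE7b.SupHomogeneousVertexBoundsTilted

end
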